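import Literature.Probability.LatticeModels.MedialInterfaceProofs
import Literature.Probability.Percolation.BoxCrossingProofs
import Literature.Probability.Percolation.PlanarDuality
import HarnessLib

/-!
# Faces at a lattice cycle avoiding the discrete boundary are inner: stub
`stub_kernel_cycle_off_zdBoundary_faces_inner` (K3) of line `hitting-tournament` for crux
`LagHandOff` (stmt-CriticalPhenomena-10268)

The pure lattice-combinatorics brick of the contact kernel of seat c5.  For discrete Dobrushin
data `E` and a CYCLE `w` of `ℤ²` all of whose vertices lie in `Ω_δ = meshDomain E.Ω E.δ` but off
the square-lattice discrete boundary
`E.zdBoundary = meshBoundary E.Ω E.δ ∪ {x | ∃ y, E.IsFaceBoundaryEdge x y}`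
(`Literature/Probability/LatticeModels/MedialInterface.lean`), every face of `ℤ²` having a vertex
of `w` as a corner is an inner face of `Ω_δ` (`E.IsInnerFace`).

Proof.

1. A site `x ∈ Ω_δ` off `E.zdBoundary` is off `meshBoundary`, so all four lattice neighbours
   are `Ω_δ`-adjacent to `x` (`adj_of_not_mem_zdBoundary`).
2. Two faces sharing a side `{x, y}` at such a site are both inner or both non-inner, since
   otherwise `{x, y}` is a face-boundary edge and `x ∈ E.zdBoundary`
   (`isInnerFace_iff_of_shared_side`); going around `x`, all four faces cornered at `x` have
   the status of the face with lower-left corner `x` (`isInnerFace_iff_of_isCorner`).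
3. Hence the lower-left faces of two ADJACENT such sites have the same status
   (`isInnerFace_iff_of_adj`), and by induction along the walk the status is constant on the
   support (`isInnerFace_iff_of_mem_support`).  If the face at the base point `u` is inner we
   are done.
4. Otherwise every face cornered at a vertex of the cycle is non-inner.  Pick a vertex `x` of
   the cycle maximising `x 0 + x 1`; its two distinct cycle neighbours `p ≠ s`
   (`IsCycle.ncard_neighborSet_toSubgraph_eq_two`) satisfy `p 0 + p 1, s 0 + s 1 ≤ x 0 + x 1`,
   so `{p, s} = {x - e₀, x - e₁}`: the cycle TURNS at `x`, and the south-west face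
   `f = x - e₀ - e₁` has the three corners `x`, `p`, `s` off the discrete boundary.  Every side
   of `f` contains one of them, so by step 1 every side of `f` is an `Ω_δ`-edge: `f` is inner, a
   contradiction.

All the face geometry is done in the two coordinates and closed by `omega` (playbook "ℤ² box &
strip geometry closes with omega").  Only definitions and lemmas of `DomainDiscretisation.lean`,
`MedialInterface.lean` (`isCorner_self`, `mem_zdBoundary_iff`, `meshBoundary_subset_zdBoundary`),
`MedialExplorationChains.lean` (`Site.ext_two`), `PlanarDuality.lean` (`zdGraph_two_adj_iff`,
adjacency of `ℤ²` in coordinates) and Mathlib's walk / cycle API are used.  Helpers live in the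
sub-namespace `KernelCycleFaces`.
-/

noncomputable section

open Set Metric
open Literature.Probability.Percolation Literature.Probability.LatticeModels
open Literature.Probability.RandomPlanarGeometry

namespace Summit.CriticalPhenomena.CardyFormulaZ2.Cruxes.LagHandOff.HittingTournament

namespace KernelCycleFaces

/-! ### Coordinates -/

/-- The corners of the face with lower-left corner `f`, in coordinates. -/
theorem isCorner_iff_coord (v f : Site 2) :
    IsCorner v f ↔ (v 0 = f 0 ∨ v 0 = f 0 + 1) ∧ (v 1 = f 1 ∨ v 1 = f 1 + 1) := by
  simp only [IsCorner, Fin.forall_fin_two]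

variable {E : DiscreteDobrushin}

/-! ### Faces around a site off the discrete boundary -/

/-- **Step 1.** A site of `Ω_δ` off the discrete boundary `E.zdBoundary` is off `meshBoundary`,
so it is `Ω_δ`-adjacent to each of its lattice neighbours. -/
theorem adj_of_not_mem_zdBoundary {x y : Site 2} (hx : x ∈ meshDomain E.Ω E.δ)
    (hxb : x ∉ E.zdBoundary) (hxy : (zdGraph 2).Adj x y) :
    (discreteDomainGraph E.Ω E.δ).Adj x y := by
  by_contra h
  exact hxb (E.meshBoundary_subset_zdBoundary ⟨hx, y, hxy, h⟩)

/-- **Step 2, one side.** Two faces `f`, `f'` sharing the side `{x, y}` at a site `x ∈ Ω_δ` off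
the discrete boundary are both inner or both non-inner: otherwise `{x, y}` (an `Ω_δ`-edge by
step 1) is a face-boundary edge and `x ∈ E.zdBoundary`. -/
theorem isInnerFace_iff_of_shared_side {x y f f' : Site 2} (hx : x ∈ meshDomain E.Ω E.δ)
    (hxb : x ∉ E.zdBoundary) (hxy : (zdGraph 2).Adj x y) (hxf : IsCorner x f)
    (hyf : IsCorner y f) (hxf' : IsCorner x f') (hyf' : IsCorner y f') :
    E.IsInnerFace f ↔ E.IsInnerFace f' := by
  by_contra h
  have hd := adj_of_not_mem_zdBoundary hx hxb hxy
  by_cases hf : E.IsInnerFace f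
  · have hf' : ¬ E.IsInnerFace f' := fun hf' => h (iff_of_true hf hf')
    exact hxb (E.mem_zdBoundary_iff.2 (Or.inr ⟨y, hd, ⟨f, hf, hxf, hyf⟩, f', hf', hxf', hyf'⟩))
  · have hf' : E.IsInnerFace f' := by_contra fun hf' => h (iff_of_false hf hf')
    exact hxb (E.mem_zdBoundary_iff.2 (Or.inr ⟨y, hd, ⟨f', hf', hxf', hyf'⟩, f, hf, hxf, hyf⟩))

/-- **Step 2, around a site.** At a site `x ∈ Ω_δ` off the discrete boundary, every face
cornered at `x` has the status of the (north-east) face with lower-left corner `x`: the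
south-east and north-west faces share the sides `{x, x + e₀}`, `{x, x + e₁}` with it, and the
south-west face shares the side `{x, x - e₀}` with the north-west face. -/
theorem isInnerFace_iff_of_isCorner {x f : Site 2} (hx : x ∈ meshDomain E.Ω E.δ)
    (hxb : x ∉ E.zdBoundary) (hf : IsCorner x f) : E.IsInnerFace f ↔ E.IsInnerFace x := by
  rw [isCorner_iff_coord] at hf
  -- the north-west face `g = x - e₀` has the status of the north-east face `x`:
  -- common side `{x, y}` with `y = x + e₁`
  have hNW : ∀ g : Site 2, x 0 = g 0 + 1 → x 1 = g 1 → (E.IsInnerFace g ↔ E.IsInnerFace x) := by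
    intro g h0 h1
    obtain ⟨y, hy0, hy1⟩ : ∃ y : Site 2, y 0 = x 0 ∧ y 1 = x 1 + 1 :=
      ⟨![x 0, x 1 + 1], by simp, by simp⟩
    refine isInnerFace_iff_of_shared_side hx hxb ((zdGraph_two_adj_iff x y).2 (by omega))
      ((isCorner_iff_coord x g).2 (by omega)) ((isCorner_iff_coord y g).2 (by omega))
      (isCorner_self x) ((isCorner_iff_coord y x).2 (by omega))
  rcases hf with ⟨h0 | h0, h1 | h1⟩
  · -- `f = x`, the north-east face itself
    rw [Site.ext_two h0 h1]
  · -- `f = x - e₁`, the south-east face: common side `{x, y}`, `y = x + e₀`, with the face `x`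
    obtain ⟨y, hy0, hy1⟩ : ∃ y : Site 2, y 0 = x 0 + 1 ∧ y 1 = x 1 :=
      ⟨![x 0 + 1, x 1], by simp, by simp⟩
    exact isInnerFace_iff_of_shared_side hx hxb ((zdGraph_two_adj_iff x y).2 (by omega))
      ((isCorner_iff_coord x f).2 (by omega)) ((isCorner_iff_coord y f).2 (by omega))
      (isCorner_self x) ((isCorner_iff_coord y x).2 (by omega))
  · -- `f = x - e₀`, the north-west face
    exact hNW f h0 h1
  · -- `f = x - e₀ - e₁`, the south-west face: common side `{x, g}` with the north-west face
    -- `g = x - e₀`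
    obtain ⟨g, hg0, hg1⟩ : ∃ g : Site 2, g 0 = x 0 - 1 ∧ g 1 = x 1 :=
      ⟨![x 0 - 1, x 1], by simp, by simp⟩
    refine Iff.trans ?_ (hNW g (by omega) hg1.symm)
    exact isInnerFace_iff_of_shared_side (y := g) hx hxb ((zdGraph_two_adj_iff x g).2 (by omega))
      ((isCorner_iff_coord x f).2 (by omega)) ((isCorner_iff_coord g f).2 (by omega))
      ((isCorner_iff_coord x g).2 (by omega)) (isCorner_self g)

/-! ### Propagation along a walk -/

/-- **Step 3, one edge.** The lower-left faces of two ADJACENT sites of `Ω_δ` off the discrete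
boundary have the same status: if `y = x + eᵢ` both are corners of the face `x`, if
`y = x - eᵢ` both are corners of the face `y`. -/
theorem isInnerFace_iff_of_adj {x y : Site 2} (hx : x ∈ meshDomain E.Ω E.δ)
    (hxb : x ∉ E.zdBoundary) (hy : y ∈ meshDomain E.Ω E.δ) (hyb : y ∉ E.zdBoundary)
    (hxy : (zdGraph 2).Adj x y) : E.IsInnerFace x ↔ E.IsInnerFace y := by
  rw [zdGraph_two_adj_iff] at hxy
  by_cases h : IsCorner y x
  · exact isInnerFace_iff_of_isCorner hy hyb h
  · have h' : IsCorner x y := by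
      rw [isCorner_iff_coord] at h ⊢
      omega
    exact (isInnerFace_iff_of_isCorner hx hxb h').symm

/-- **Step 3, along a walk.** If every vertex of a lattice walk lies in `Ω_δ` off the discrete
boundary, the lower-left face of every vertex has the status of the lower-left face of the
starting vertex. -/
theorem isInnerFace_iff_of_mem_support {v t : Site 2} (w : (zdGraph 2).Walk v t)
    (hw : ∀ x ∈ w.support, x ∈ meshDomain E.Ω E.δ ∧ x ∉ E.zdBoundary) :
    ∀ x ∈ w.support, (E.IsInnerFace x ↔ E.IsInnerFace v) := by
  induction w with
  | nil =>
    intro x hx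
    rw [SimpleGraph.Walk.support_nil, List.mem_singleton] at hx
    rw [hx]
  | cons h p ih =>
    intro x hx
    rw [SimpleGraph.Walk.support_cons, List.mem_cons] at hx
    rcases hx with rfl | hx
    · exact Iff.rfl
    · have hp : ∀ y ∈ p.support, y ∈ meshDomain E.Ω E.δ ∧ y ∉ E.zdBoundary := fun y hy =>
        hw y (by rw [SimpleGraph.Walk.support_cons]; exact List.mem_cons_of_mem _ hy)
      have ha := hw _ (SimpleGraph.Walk.start_mem_support _)
      have hb := hp _ (SimpleGraph.Walk.start_mem_support p)
      exact (ih hp x hx).trans (isInnerFace_iff_of_adj ha.1 ha.2 hb.1 hb.2 h).symm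

end KernelCycleFaces

open KernelCycleFaces in
/-- **K3 `stub_kernel_cycle_off_zdBoundary_faces_inner`.** If a lattice CYCLE of `ℤ²` has all
its vertices in `Ω_δ` but none on the discrete boundary `E.zdBoundary`, then every face having a
vertex of the cycle as a corner is an inner face of `Ω_δ`: around a non-boundary vertex the four
faces are all inner or all non-inner, and this common status propagates along the cycle; in the
all-non-inner case look at a vertex `x` of the cycle maximising `x 0 + x 1` — its two cycle
neighbours are `x - e₀` and `x - e₁` (the cycle turns at `x`), so three corners of the south-west
face at `x` are off the discrete boundary, every side of that face is an `Ω_δ`-edge, and the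
face is inner after all. -/
theorem stub_kernel_cycle_off_zdBoundary_faces_inner :
    ∀ (E : DiscreteDobrushin) (u : Site 2) (w : (zdGraph 2).Walk u u), w.IsCycle →
      (∀ x ∈ w.support, x ∈ meshDomain E.Ω E.δ ∧ x ∉ E.zdBoundary) →
      ∀ x ∈ w.support, ∀ f : Site 2, IsCorner x f → E.IsInnerFace f := by
  intro E u w hc hw
  -- it suffices that the lower-left face at the base point `u` is inner
  suffices hu : E.IsInnerFace u from fun x hx f hf =>
    (isInnerFace_iff_of_isCorner (hw x hx).1 (hw x hx).2 hf).2
      ((isInnerFace_iff_of_mem_support w hw x hx).2 hu)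
  by_contra hu
  -- a vertex of the cycle maximising `z 0 + z 1` ...
  obtain ⟨x, hx, hmax⟩ := w.support.toFinset.exists_max_image (fun z : Site 2 => z 0 + z 1)
    ⟨u, List.mem_toFinset.2 w.start_mem_support⟩
  rw [List.mem_toFinset] at hx
  -- ... and its two distinct cycle neighbours `p`, `s`
  obtain ⟨p, s, hps, hN⟩ := Set.ncard_eq_two.1 (hc.ncard_neighborSet_toSubgraph_eq_two hx)
  have hp : w.toSubgraph.Adj x p := by
    rw [← SimpleGraph.Subgraph.mem_neighborSet, hN]
    exact Set.mem_insert _ _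
  have hs : w.toSubgraph.Adj x s := by
    rw [← SimpleGraph.Subgraph.mem_neighborSet, hN]
    exact Set.mem_insert_of_mem _ rfl
  have hpS : p ∈ w.support := w.mem_verts_toSubgraph.1 hp.snd_mem
  have hsS : s ∈ w.support := w.mem_verts_toSubgraph.1 hs.snd_mem
  have hxp := (zdGraph_two_adj_iff x p).1 hp.adj_sub
  have hxs := (zdGraph_two_adj_iff x s).1 hs.adj_sub
  have hpm : p 0 + p 1 ≤ x 0 + x 1 := hmax p (List.mem_toFinset.2 hpS)
  have hsm : s 0 + s 1 ≤ x 0 + x 1 := hmax s (List.mem_toFinset.2 hsS)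
  have hps' : ¬ (p 0 = s 0 ∧ p 1 = s 1) := fun h => hps (Site.ext_two h.1 h.2)
  -- the cycle turns at `x`: `{p, s} = {x - e₀, x - e₁}`
  have hp' : (p 0 + 1 = x 0 ∧ p 1 = x 1) ∨ (p 0 = x 0 ∧ p 1 + 1 = x 1) := by omega
  have hs' : (s 0 + 1 = x 0 ∧ s 1 = x 1) ∨ (s 0 = x 0 ∧ s 1 + 1 = x 1) := by omega
  clear hxp hxs hpm hsm hmax
  -- the south-west face `f = x - e₀ - e₁` at `x` is non-inner ...
  obtain ⟨f, hf0, hf1⟩ : ∃ f : Site 2, f 0 + 1 = x 0 ∧ f 1 + 1 = x 1 :=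
    ⟨![x 0 - 1, x 1 - 1], by simp, by simp⟩
  have hxf : IsCorner x f := (isCorner_iff_coord x f).2 (by omega)
  have hf : ¬ E.IsInnerFace f := fun h => hu ((isInnerFace_iff_of_mem_support w hw x hx).1
    ((isInnerFace_iff_of_isCorner (hw x hx).1 (hw x hx).2 hxf).1 h))
  -- ... but its corners are `x`, `p`, `s`, all off the discrete boundary, and `f` itself
  have key : ∀ v, IsCorner v f →
      (v ∈ meshDomain E.Ω E.δ ∧ v ∉ E.zdBoundary) ∨ (v 0 = f 0 ∧ v 1 = f 1) := by
    intro v hv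
    rw [isCorner_iff_coord] at hv
    have h4 : (v 0 = x 0 ∧ v 1 = x 1) ∨ (v 0 = p 0 ∧ v 1 = p 1) ∨ (v 0 = s 0 ∧ v 1 = s 1) ∨
        (v 0 = f 0 ∧ v 1 = f 1) := by
      omega
    rcases h4 with h | h | h | h
    · exact Or.inl (Site.ext_two h.1 h.2 ▸ hw x hx)
    · exact Or.inl (Site.ext_two h.1 h.2 ▸ hw p hpS)
    · exact Or.inl (Site.ext_two h.1 h.2 ▸ hw s hsS)
    · exact Or.inr h
  -- so every side of `f` contains a corner off the discrete boundary and is an `Ω_δ`-edge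
  refine hf fun v v' hv hv' hvv' => ?_
  rcases key v hv with hv | hv
  · exact adj_of_not_mem_zdBoundary hv.1 hv.2 hvv'
  rcases key v' hv' with hv' | hv'
  · exact (adj_of_not_mem_zdBoundary hv'.1 hv'.2 hvv'.symm).symm
  exfalso
  rw [zdGraph_two_adj_iff] at hvv'
  omega

end Summit.CriticalPhenomena.CardyFormulaZ2.Cruxes.LagHandOff.HittingTournament

end
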